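import Summits.ABC.IUTFork.Repair.CandInternal6Scal
import Summits.ABC.IUTFork.Repair.ObstructionSS12
import Summits.ABC.IUTFork.Repair.CandMochizuki33
import Summits.ABC.IUTFork.Repair.CandMochizuki31
import Summits.ABC.IUTFork.Repair.CandMochizuki1
import Summits.ABC.IUTFork.Repair.CandMochizuki2
import Summits.ABC.IUTFork.Repair.CandMochizuki3
import Summits.ABC.IUTFork.Repair.CandMochizuki4
import Summits.ABC.IUTFork.Repair.CandMochizuki5
import Summits.ABC.IUTFork.Repair.CandMochizuki6
import Summits.ABC.IUTFork.Repair.CandMochizuki7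
import Summits.ABC.IUTFork.Repair.CandMochizuki40
import Summits.ABC.IUTFork.Repair.CandMochizuki41
import HarnessLib

/-!
# REPAIR branch B1 / CandMochizuki32Scal — the SCAL COLUMN (door (b): the uniformiser is an indeterminacy scalar) for the sub-cell B1 rows
# M32a/b/c, X07c, M31 (m3) · M03/M04/M36 (m2) · M01/M02/M45/M47 (m1) · M40 (m4), at abc-iut-rp-s2's PINNED scaling bed with the signed datum

PROOF-ONLY file (no definition, no `Prop` fact; class `Mochizuki`, sub-cell B1, seat abc-iut-rp-m3 gen 3; REPAIR-SPEC v0.4 §3 PROFILE RULE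
«… a T-b cell on P♮ and U (and SCAL when landed)»; the B1 rows had no SCAL cells except RP-M01b (rp-m1 `CandMochizuki1Scal`) and RP-M47a/b
(rp-m1 `CandMochizuki7.fullIsm_scalingShells` / `not_ismIsometric_scalingShells`)). TAKES NO SIDE between Mochizuki, Scholze–Stix, Joshi,
Dupuy–Hilado or anyone; nothing here asserts abc or [IUTchIII] Cor. 3.12 proved or refuted; candidates are hypotheses — typed ≠ proved,
instantiated ≠ endorsed. Closed theorems about TOY MODEL DATA, BY NAME on abc-iut-w4-d098's `Repair.ScalarShells` (p429955: `scalingShells p`,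
"Ism" = all of `ℚˣ`, `sBall`, `sVol_sBall`, `sBall_injective`), abc-iut-rp-s2's door-(b) PINNED BED `Repair.ObstructionSS10` (p431972: `sLattice p`,
`sSetting p`, `rho p`, `carrier`, `door_b_kummerB`, `door_b_thetaPinned`, `door_b_S`; `sSetting_thetaRegion` = the HONEST ball `B_{j²}`,
`sSetting_qRegion` = `B_1`) with its price file `Repair.ObstructionSS12` (p433038-lineage: `door_b_not_thetaFinite`, `door_b_not_statement`,
`door_b_not_bridgeHyps`, `door_b_negLogQ`), abc-iut-rp-d3's SIGNED datum `Repair.CandInternal6Scal.qKs` (p434299-lineage: `scal_pinnedRegions3`,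
`scal_S`, `scal_pilotKummerCompat` — the FOLD #2 (D6) safety rail holds: the carrier is `sLattice`, not the balls-only `sFull`), and on the landed
candidate files `Repair.CandMochizuki1/2/3/4/5/6/7/31/32/33/40`. Nothing restated; DEFS-FREEZE kept.

THE BED (every prime `p`): one valuation, packets = lines, (Ind2) = ALL scalars (so the Θ→q rescaling `x ↦ q^{1−j²}·x` IS an indeterminacy),
Θ-image `B_{j²}`, q-image `B_1` — HONESTLY `j²`-SCALED —, pins ✓ and S ✓ through the (Ind2)-carrier; the PRICE (by name): Step (x) volume
invariance FAILS (`CandInternal6Scal.scal_stepX_fails`), the hull of the (Ind2)-orbit is everything, `−|log(Θ)| = +∞` (`door_b_not_thetaFinite`), the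
typed Corollary and the bridge hypotheses FAIL (`door_b_not_statement`, `door_b_not_bridgeHyps`) — print's own «useless from the point of view of
log-volume estimates» ([IUTchIII] Rmk 3.11.1 (vii)); T-c word of the rows holding here: SAT⊖[door (b)].

CELLS (EVAL-LOG column «SCAL»; ✓ HOLDS / ✗ FAILS; bed (`sLattice p`, `sSetting p`, `rho p`, `qKs p`)):
* m3 — RP-M32a `H` ✓ (`H ⟺ S` under the pins; `M32a_scal`) · M32b `H'` ✓ · M32c `H''` ✓ (hull = everything); RP-X07c `AO4` ✗ (`not_AO4_scal`:
  `B_1 ≠ B_4` — identification WITHOUT indeterminacy fails on the FOURTH S-bed (P♮, U, P♮₁, SCAL)); **RP-M31 `H N ⟺ N = 1` (`M31_scal_iff`): the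
  door-(b) bed is HONESTLY `j²`-scaled (`N = 1` ✓ — unlike CM's siblings P♮/P♮₁ where honest scaling is what fails) and carries S: of the CM∀
  barrier's hypotheses it is Step (x) (and finiteness) that it gives up, kernel-located**; RP-M06 n/a (the cap reads the log-volume of a hull that
  is not defined here: `−|log(Θ)| = +∞`).
* m2 — M03a ✓, M03b ✓, M04a ✓, M04b ✓ (ρ qK ⊆ hull), M36a ✓, M36b ✓ (sat = id), M36d ✓ VACUOUSLY (`−|log(Θ)| = ⊤`); M04c/M36c n/a (no typed full
  situation over `sLattice` is used here / `thetaLocal` junk).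
* m1 — **M01a ✗ (its Statement conjunct fails) · M01b ✗ (= rp-m1's `not_H'_at_scal` on this carrier: (ΘInd) denies the (Ind2)-transport that
  realises S here) · M01c ✓ (`M01c_scal`: the Θ-pilot's own PN-volume `−avgJsq·log p` IS `avgJsq × (−|log q|)` — (C11)–(C14)'s degree identity
  and S COEXIST at door (b)) · M02a ✓ · M02b ✗ (`not_M02b_scal`: the bed IS a «single hol. str.» in rp-m1's typed sense — `SingleHolStr` ⟺ the
  `N = 1` class — AND carries S: the Step (x) hypothesis of rp-m1's necessity theorem `CandMochizuki3.H'_of_residual` is load-bearing, kernel-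
  witnessed) · M45 ✗ (`−|log(Θ)| = ⊤`) · M47a ✓ / M47b ✗ (rp-m1's signature theorems, cited) .**
* m4 — `Placewise` ✗, M40a `H` ✓, M40b `H'` ✗ (one place: `Placewise ⟺ Statement`, which fails here).
Package `profile_scal`. READING (neutral): at the door-(b) bed the REGION/HULL/VOLUME-reading rows hold together with honest `j²`-scaling and the
(C11)–(C14) degree identity, the NO-TRANSPORT / own-volume-strict / finite-hull rows fail, and the «distinct hol. strs.» reading (M02b) fails while
S holds — every row's truth value here is decided by the one bit «the uniformiser is an indeterminacy scalar» and its price (Step (x), finiteness).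
No verdict word moves. [claim: Mochizuki2012, status: disputed] for every IUT noun; [cite: ScholzeStix2018, §2.2 pp. 9–10] for the countermodel side.

v2 (APPEND, gen 3, 2026-08-26T11:40Z): §6 — the SCAL cell of the NEW row RP-M51 (rp-m4's `CandMochizuki41`, (C14)/(Lin)-denial, p440036): at the
door-(b) bed some label has `thetaLocal = ⊤` (`exists_thetaLocal_eq_top_scal`, from rp-s2's `door_b_not_thetaFinite` at the one place), so (Lin) —
which asks for REAL hull volumes `r·own` — FAILS and **`H` HOLDS, VACUOUSLY-BY-INFINITY** (`M51_H_scal`), with S true: recorded with that label so the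
cell is not read as a non-linearity phenomenon (contrast P♮₁, where `H` holds by a genuine ratio mismatch `2/3 ≠ 2/5`). No side taken.
-/

noncomputable section

open Set

namespace Summit.ABC.IUTFork.Repair.CandMochizuki32Scal

open Thm311 Cor312 Cor312Vol Cor312.Checks Cor312.IdentifiedNonVacuity Cor312Vol.NaiveWitness Cor312Vol.PinnedWitness
  Cor312Vol.GluedMonoids.Naive Literature.IUT.LogThetaLattice ScalarShells ObstructionSS10 ObstructionSS12 CandInternal6Scal
  Repair.CandMochizuki32

variable (p : ℕ) [hp : Fact p.Prime]

/-! ## 1. m3 rows: RP-M32a/b/c, RP-X07c, RP-M31 -/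

/-- **RP-M32a at SCAL: `H` HOLDS** (`CandMochizuki32.H_of_S` with rp-s2's `door_b_kummerB`, rp-d3's `scal_pinnedRegions3` / `scal_S`). [folklore] -/
theorem M32a_scal : H (sLattice p) (sSetting p) (rho p) (qKs p) :=
  H_of_S _ _ _ _ (door_b_kummerB p _) (scal_pinnedRegions3 p) (scal_S p)

/-- Reading R3 at every label of the SCAL bed. [folklore] -/
theorem scal_reading3 (j : Checks.toyIndex.Label) (vQ : Checks.toyIndex.VQ) : (sSetting p).qRegion j vQ ∈ (sSetting p).possibleImages j vQ :=
  (H_iff_reading3 _ _ _ _).1 (M32a_scal p) j vQ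

/-- **RP-M32b at SCAL: `H'` HOLDS.** [folklore] -/
theorem M32b_scal : H' (sLattice p) (sSetting p) (rho p) (qKs p) := H'_of_H _ _ _ _ (M32a_scal p)

/-- **RP-M32c at SCAL: `H''` HOLDS.** [folklore] -/
theorem M32c_scal : H'' (sLattice p) (sSetting p) (rho p) (qKs p) := H''_of_H _ _ _ _ (M32a_scal p)

/-- **RP-X07c at SCAL: `AO4` FAILS** — at the label `2` the q-image `B_1` is no Kummer image `B_4` of the Θ-pilot: identification WITHOUT
indeterminacy fails on this S-bed too (the fourth, after P♮, U, P♮₁). [folklore] -/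
theorem not_AO4_scal : ¬ CandMochizuki33.AO4 (sLattice p) (sSetting p) (rho p) (qKs p) := by
  intro h
  obtain ⟨m, e⟩ := (CandMochizuki33.AO4_iff _ _ _ _).1 h 2 ()
  rw [sSetting_qRegion, sSetting_thetaRegion, if_neg (by decide), if_neg (by decide)] at e
  have h14 : (1 : ℤ) = jsq (2 : Checks.toyIndex.Label) := sBall_injective p ⊤ 2 () e
  exact absurd h14 (by decide)

/-- The log-volume of `ρ Ψ` at a label `j ≥ 1` of the SCAL bed: `−j²·log p` (the honest Θ-ball `B_{j²}`, rp-s2's `rho_Psi`). [folklore] -/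
theorem scal_rhoPsi_logvol (i : Fin Checks.toyIndex.lstar) (vQ : Checks.toyIndex.VQ) :
    ((sLattice p).D (sSetting p).n).logvol _ vQ (rho p ((sLattice p).D (sSetting p).n).Ψ (Setting.labelSucc i) vQ) =
      -((jsq (Setting.labelSucc i) : ℤ) : ℝ) * Real.log p := by
  show sVol p ⊤ _ vQ (rho p (fun v _ => Psi p v) (Setting.labelSucc i) vQ) = _
  rw [rho_Psi, if_neg (Setting.labelSucc_ne_zero i), sVol_sBall]

/-- **RP-M31 at SCAL: the `N`-th-power class `H N` HOLDS IFF `N = 1`** — the door-(b) bed is HONESTLY `j²`-scaled (`logvol(ρ Ψ_j) = −j²·log p`,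
`qLocal_j = −log p`): of the CM∀ barrier's hypotheses (pins, (ii)(b), Step (x), honest scaling, label-independence, `|log q| > 0`) it keeps
honest scaling and gives up Step (x) (`CandInternal6Scal.scal_stepX_fails`). [folklore] -/
theorem M31_scal_iff (N : ℕ) : CandMochizuki31.H (sLattice p) (sSetting p) (rho p) (qKs p) N ↔ N = 1 := by
  have hl : 0 < Real.log p := Real.log_pos (by exact_mod_cast hp.out.one_lt)
  constructor
  · intro h
    have h0 := h ⟨0, by decide⟩ ()
    rw [scal_rhoPsi_logvol, sSetting_qLocal p (Setting.labelSucc_ne_zero _)] at h0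
    have e1 : jsq (Setting.labelSucc (T := Checks.toyIndex) ⟨0, by decide⟩) = 1 := by decide
    rw [e1] at h0
    push_cast at h0
    have hN : (N : ℝ) = 1 := by nlinarith
    exact_mod_cast hN
  · rintro rfl i vQ
    rw [scal_rhoPsi_logvol, sSetting_qLocal p (Setting.labelSucc_ne_zero _), CandMochizuki5.jsq_labelSucc]
    push_cast
    ring

/-! ## 2. m2 rows (rp-m2's `CandMochizuki2/4/6`): RP-M03a/b, RP-M04a/b, RP-M36a/b/d -/

omit hp in
/-- **RP-M03a at SCAL: HOLDS** (constant assignment). [folklore] -/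
theorem M03a_scal : ∃ Out : CandMochizuki2.OutputAssignment (sLattice p) (sSetting p), CandMochizuki2.H (sLattice p) (sSetting p) Out :=
  ⟨_, CandMochizuki2.H_const _ _⟩

/-- **RP-M03b at SCAL: HOLDS** (Reading R3 through `ρ`). [folklore] -/
theorem M03b_scal : ∃ Out : CandMochizuki2.OutputAssignment (sLattice p) (sSetting p),
    CandMochizuki2.H' (sLattice p) (sSetting p) (rho p) (qKs p) Out :=
  (CandMochizuki2.exists_H'_iff _ _ _ _).2 fun _ j vQ => by
    rw [← scal_qPinned p j vQ]
    exact scal_reading3 p j vQ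

/-- **RP-M04a at SCAL: HOLDS** (`H ⟺ S` under the pins). [folklore] -/
theorem M04a_scal : CandMochizuki4.H (sLattice p) (sSetting p) (rho p) (qKs p) :=
  (CandMochizuki4.H_iff_S_of_pinned3 _ _ _ _ (door_b_kummerB p _) (scal_pinnedRegions3 p)).2 (scal_S p)

/-- The hull-level clause `PilotKummerCompatHull` HOLDS at SCAL (from rp-d3's datum-level `scal_pilotKummerCompat` through the Θ-pin). [folklore] -/
theorem scal_pilotKummerCompatHull : PilotKummerCompatHull (sLattice p) (sSetting p) (rho p) (qKs p) :=
  pilotKummerCompatHull_of_region _ _ _ _ (door_b_thetaPinned p)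
    (pilotKummerCompatRegion_of_pilotKummerCompat _ _ _ _ (door_b_thetaPinned p).1 (scal_pilotKummerCompat p))

/-- **RP-M04b at SCAL: HOLDS** (`ρ qK ⊆ hull`). [folklore] -/
theorem M04b_scal : CandMochizuki4.H' (sLattice p) (sSetting p) (rho p) (qKs p) :=
  fun _ _ vQ => scal_pilotKummerCompatHull p _ vQ

omit hp in
/-- **RP-M36a at SCAL (sat = id): HOLDS.** [folklore] -/
theorem M36a_scal : CandMochizuki6.H (sLattice p) (sSetting p) (fun _ _ U => U) :=
  ⟨fun _ _ _ => subset_rfl, fun _ vQ _ hU => (Set.subset_sUnion_of_mem hU).trans (((sSetting p).frame _ vQ).subset_hull _)⟩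

/-- **RP-M36b at SCAL with the honest saturation `id`: HOLDS** (the q-ball IS a possible image). [folklore] -/
theorem M36b_scal : CandMochizuki6.H' (sLattice p) (sSetting p) (rho p) (qKs p) (fun _ _ U => U) :=
  ⟨M36a_scal p, fun i vQ => ⟨rho p (qKs p) _ vQ, (scal_qPinned p _ vQ) ▸ scal_reading3 p (Setting.labelSucc i) vQ, subset_rfl⟩⟩

/-- `−|log(Θ)| = +∞` at SCAL (rp-s2's `door_b_not_thetaFinite`). [folklore] -/
theorem scal_negLogTheta : (sSetting p).negLogTheta = ⊤ := by
  unfold Setting.negLogTheta; rw [if_neg (door_b_not_thetaFinite p)]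

/-- **RP-M36d at SCAL: HOLDS VACUOUSLY** (`−|log(q)| ≤ ⊤`): the global `≤`-volume reading is ⊤-true exactly where the typed Corollary's finiteness
conjunct fails — recorded so the row's SCAL cell is not misread as support. [folklore] -/
theorem M36d_scal : CandMochizuki6.H''' (sLattice p) (sSetting p) := by
  show (((sSetting p).negLogQ : ℝ) : WithTop ℝ) ≤ (sSetting p).negLogTheta
  rw [scal_negLogTheta]; exact le_top

/-! ## 3. m1 rows (rp-m1's `CandMochizuki1/3/5/7`): RP-M01a/b/c, RP-M02a/b, RP-M45, RP-M47a/b -/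

/-- **RP-M01a at SCAL: FAILS** (its Statement conjunct: rp-s2's `door_b_not_statement`). [folklore] -/
theorem not_M01a_scal : ¬ CandMochizuki1.H (sLattice p) (sSetting p) (rho p) (qKs p) := fun h => door_b_not_statement p h.2

/-- **RP-M01b at SCAL: FAILS** — (ΘInd) denies the ⟨(Ind1)∪(Ind2)⟩-transport of a Θ-image onto the q-datum that rp-d3's `scal_pilotKummerCompat`
exhibits (`carrier ∈ (Ind2)`); rp-m1's `CandMochizuki1Scal.not_H'_at_scal` is the same cell on the balls-only carrier. [folklore] -/
theorem not_M01b_scal : ¬ CandMochizuki1.H' (sLattice p) (sSetting p) (rho p) (qKs p) := fun h =>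
  (CandMochizuki1.H'_iff_not_pilotKummerCompat _ _ _ _).1 h (scal_pilotKummerCompat p)

/-- The Θ-pilot's OWN procession-normalised volume at SCAL: `avgJsq · (−|log q|) = −avgJsq·log p` (every Kummer image is the honest ball
`B_{j²}` of volume `−j²·log p`; `−|log q| = −log p`). [folklore] -/
theorem scal_thetaPilotOwnVol (m : ℤ) :
    CandMochizuki1.thetaPilotOwnVol (sLattice p) (sSetting p) m = CandMochizuki1.avgJsq Checks.toyIndex * (sSetting p).negLogQ := by
  rw [door_b_negLogQ]
  unfold CandMochizuki1.thetaPilotOwnVol CandMochizuki1.avgJsq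
  rw [mul_comm, ← CandMochizuki1.processionNormalized_const_mul]
  congr 1
  funext i
  rw [finsum_unique]
  show sVol p ⊤ _ _ ((sSetting p).thetaRegion m (Setting.labelSucc i) (default : Checks.toyIndex.VQ)) = _
  rw [sSetting_thetaRegion, if_neg (Setting.labelSucc_ne_zero i), sVol_sBall, CandMochizuki5.jsq_labelSucc]
  push_cast
  ring

/-- **RP-M01c at SCAL: HOLDS** — [Cmt2018-05] (C11)–(C14)'s degree identity «the Θ-pilot's degree is (the average of the j²) times the
q-pilot's» holds at the door-(b) bed, where S ALSO holds: the identity and S coexist once Step (x) is given up. [folklore] -/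
theorem M01c_scal : CandMochizuki1.H'' (sLattice p) (sSetting p) (rho p) (qKs p) := fun m => scal_thetaPilotOwnVol p m

omit hp in
/-- Every Kummer image of the Θ-pilot at a label of `𝔽_l^⋇` of SCAL is admissible (a ball). [folklore] -/
theorem scal_thetaRegionsAdm : ThetaRegionsAdm (sSetting p) := fun m i vQ => by
  show (∃ k, (sSetting p).thetaRegion m (Setting.labelSucc i) vQ = sBall p ⊤ (Setting.labelSucc i) vQ k) ∨
    (Setting.labelSucc i = 0 ∧ (sSetting p).thetaRegion m (Setting.labelSucc i) vQ = {0})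
  rw [sSetting_thetaRegion, if_neg (Setting.labelSucc_ne_zero i)]
  exact Or.inl ⟨jsq (Setting.labelSucc i), rfl⟩

omit hp in
/-- **RP-M02a at SCAL: HOLDS** (admissible Θ-images ∧ Thm. 3.11 (ii)(a), the latter by `rfl` for rp-s2's column). [folklore] -/
theorem M02a_scal : CandMochizuki3.H (sLattice p) (sSetting p) (rho p) (qKs p) :=
  (CandMochizuki3.H_iff _ _ _ _).2 ⟨scal_thetaRegionsAdm p, fun _ _ _ _ h => ⟨h, rfl⟩⟩

/-- **RP-M02b at SCAL: FAILS** — the bed IS a «single hol. str.» in rp-m1's typed sense (`SingleHolStr` ⟺ under the q-pin the `N = 1` class of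
RP-M31, which HOLDS here: honest `j²`-scaling) and yet carries S: the Step (x) hypothesis of rp-m1's necessity theorem `CandMochizuki3.H'_of_residual`
(«residual ⇒ ¬SingleHolStr on settings with Step (x) …») is load-bearing. [folklore] -/
theorem not_M02b_scal : ¬ CandMochizuki3.H' (sLattice p) (sSetting p) (rho p) (qKs p) := fun h =>
  h ((CandMochizuki3.singleHolStr_iff_scaled _ _ _ _ (scal_qPinned p)).2 ((CandMochizuki31.H_one_iff _ _ _ _).1 ((M31_scal_iff p 1).2 rfl)))

/-- **RP-M45 at SCAL: FAILS** (`−|log(Θ)| = ⊤`). [folklore] -/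
theorem not_M45_scal : ¬ CandMochizuki5.H (sLattice p) (sSetting p) (rho p) (qKs p) := fun h => h.1 (scal_negLogTheta p)

/-- **RP-M47a at SCAL: HOLDS, RP-M47b FAILS** (rp-m1's `fullIsm_scalingShells` / `not_ismIsometric_scalingShells`, cited on this carrier: every
shell-preserving automorphism of the line is a scalar of `ℚˣ` = Ism, but Ism ∋ `p` is not isometric). [folklore] -/
theorem M47ab_scal : CandMochizuki7.H (sLattice p) (sSetting p) (rho p) (qKs p) ∧ ¬ CandMochizuki7.H' (sLattice p) (sSetting p) (rho p) (qKs p) :=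
  ⟨CandMochizuki7.fullIsm_scalingShells p, fun h => CandMochizuki7.not_ismIsometric_scalingShells p h.2⟩

/-! ## 4. m4 rows (rp-m4's `CandMochizuki40`): one place -/

/-- **`Placewise` FAILS at SCAL** (one place: placewise = the typed Statement, which fails here). [folklore] -/
theorem not_placewise_scal : ¬ CandMochizuki40.Placewise (sSetting p) := fun h =>
  door_b_not_statement p ((CandMochizuki40.placewise_iff_statement_onePlace (sSetting p)).1 h)

/-- **RP-M40a at SCAL: HOLDS** (`H = ¬Placewise`). [folklore] -/
theorem M40a_scal : CandMochizuki40.H (sSetting p) := not_placewise_scal p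

omit hp in
/-- **RP-M40b at SCAL: FAILS** (one-place collapse). [folklore] -/
theorem not_M40b_scal : ¬ CandMochizuki40.H' (sSetting p) := CandMochizuki40.not_H'_onePlace (sSetting p)

/-! ## 5. The package -/

/-- **THE SCAL COLUMN OF SUB-CELL B1, packaged** (rp-s2's door-(b) pinned bed with rp-d3's signed datum; every prime `p`): pins ∧ S ∧ C (rp-d3) ∧
¬ThetaFinite ∧ ¬Statement (rp-s2); m3 `H`/`H'`/`H''` ✓, `AO4` ✗, `H 1` ✓, `H 2` ✗; m2 M03a/b, M04a/b, M36a/b/d ✓; m1 M01a ✗, M01b ✗, M01c ✓, M02a ✓,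
M02b ✗, M45 ✗, M47a ✓, M47b ✗; m4 Placewise ✗, M40a ✓, M40b ✗. [claim: Mochizuki2012, status: disputed] -/
theorem profile_scal :
    (PinnedRegions3 (sLattice p) (sSetting p) (rho p) (qKs p) ∧ PilotKummerIndRelated (sLattice p) (sSetting p) (rho p) (qKs p) ∧
      PilotKummerCompat (sLattice p) (sSetting p) (qKs p) ∧ ¬ (sSetting p).ThetaFinite ∧ ¬ (sSetting p).Statement) ∧
    (H (sLattice p) (sSetting p) (rho p) (qKs p) ∧ H' (sLattice p) (sSetting p) (rho p) (qKs p) ∧ H'' (sLattice p) (sSetting p) (rho p) (qKs p) ∧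
      ¬ CandMochizuki33.AO4 (sLattice p) (sSetting p) (rho p) (qKs p) ∧
      CandMochizuki31.H (sLattice p) (sSetting p) (rho p) (qKs p) 1 ∧ ¬ CandMochizuki31.H (sLattice p) (sSetting p) (rho p) (qKs p) 2) ∧
    ((∃ Out : CandMochizuki2.OutputAssignment (sLattice p) (sSetting p), CandMochizuki2.H (sLattice p) (sSetting p) Out) ∧
      (∃ Out : CandMochizuki2.OutputAssignment (sLattice p) (sSetting p), CandMochizuki2.H' (sLattice p) (sSetting p) (rho p) (qKs p) Out) ∧
      CandMochizuki4.H (sLattice p) (sSetting p) (rho p) (qKs p) ∧ CandMochizuki4.H' (sLattice p) (sSetting p) (rho p) (qKs p) ∧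
      CandMochizuki6.H (sLattice p) (sSetting p) (fun _ _ U => U) ∧ CandMochizuki6.H' (sLattice p) (sSetting p) (rho p) (qKs p) (fun _ _ U => U) ∧
      CandMochizuki6.H''' (sLattice p) (sSetting p)) ∧
    (¬ CandMochizuki1.H (sLattice p) (sSetting p) (rho p) (qKs p) ∧ ¬ CandMochizuki1.H' (sLattice p) (sSetting p) (rho p) (qKs p) ∧
      CandMochizuki1.H'' (sLattice p) (sSetting p) (rho p) (qKs p) ∧ CandMochizuki3.H (sLattice p) (sSetting p) (rho p) (qKs p) ∧
      ¬ CandMochizuki3.H' (sLattice p) (sSetting p) (rho p) (qKs p) ∧ ¬ CandMochizuki5.H (sLattice p) (sSetting p) (rho p) (qKs p) ∧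
      CandMochizuki7.H (sLattice p) (sSetting p) (rho p) (qKs p) ∧ ¬ CandMochizuki7.H' (sLattice p) (sSetting p) (rho p) (qKs p)) ∧
    (¬ CandMochizuki40.Placewise (sSetting p) ∧ CandMochizuki40.H (sSetting p) ∧ ¬ CandMochizuki40.H' (sSetting p)) :=
  ⟨⟨scal_pinnedRegions3 p, scal_S p, scal_pilotKummerCompat p, door_b_not_thetaFinite p, door_b_not_statement p⟩,
    ⟨M32a_scal p, M32b_scal p, M32c_scal p, not_AO4_scal p, (M31_scal_iff p 1).2 rfl, fun h => absurd ((M31_scal_iff p 2).1 h) (by decide)⟩,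
    ⟨M03a_scal p, M03b_scal p, M04a_scal p, M04b_scal p, M36a_scal p, M36b_scal p, M36d_scal p⟩,
    ⟨not_M01a_scal p, not_M01b_scal p, M01c_scal p, M02a_scal p, not_M02b_scal p, not_M45_scal p, (M47ab_scal p).1, (M47ab_scal p).2⟩,
    ⟨not_placewise_scal p, M40a_scal p, not_M40b_scal p⟩⟩

/-! ## 6. (appended v2) RP-M51 (rp-m4's `CandMochizuki41`) at SCAL: (Lin) fails by INFINITY -/

/-- At the door-(b) bed SOME label of `𝔽_l^⋇` has `thetaLocal = ⊤` (else `−|log(Θ)|` would be finite — one place —, against rp-s2's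
`door_b_not_thetaFinite`). [folklore] -/
theorem exists_thetaLocal_eq_top_scal : ∃ i : Fin Checks.toyIndex.lstar, (sSetting p).thetaLocal (Setting.labelSucc i) () = ⊤ := by
  by_contra h
  push Not at h
  refine door_b_not_thetaFinite p ⟨fun i vQ => ?_, fun i => Set.toFinite _⟩
  cases vQ
  exact h i

/-- **RP-M51 at SCAL: `H` (= ¬(Lin)) HOLDS — by infinity**: (Lin) at the one place would make every `thetaLocal` a real multiple of the own
volume, hence finite. Census label: VACUOUS-BY-⊤ (not a ratio mismatch); S holds on the same bed (rp-d3's `scal_S`). [claim: Mochizuki2012, status: disputed] -/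
theorem M51_H_scal : CandMochizuki41.H (sLattice p) (sSetting p) := by
  intro hLin
  obtain ⟨i, hi⟩ := exists_thetaLocal_eq_top_scal p
  obtain ⟨r, hr⟩ := hLin 0 ()
  rw [hr i] at hi
  exact WithTop.coe_ne_top hi

/-- **RP-M51 SCAL profile, packaged**: `H` ∧ S ∧ ¬ThetaFinite ∧ ¬Statement at the door-(b) bed. [claim: Mochizuki2012, status: disputed] -/
theorem M51_scal_profile :
    CandMochizuki41.H (sLattice p) (sSetting p) ∧ PilotKummerIndRelated (sLattice p) (sSetting p) (rho p) (qKs p) ∧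
      ¬ (sSetting p).ThetaFinite ∧ ¬ (sSetting p).Statement :=
  ⟨M51_H_scal p, scal_S p, door_b_not_thetaFinite p, door_b_not_statement p⟩

end Summit.ABC.IUTFork.Repair.CandMochizuki32Scal

end
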